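import Summits.QuantumFields.BalabanUV.Beta.D1BFx.MomentTransferPeriodicSum
import Literature.MathematicalPhysics.QuantumFieldTheory.Balaban1983to89.Beta.MinimiserIdentityForm

/-!
# `BalabanUV.Beta.D1BFx.MomentTransferPeriodicEntry` — road «BF-x» for binder row D1, leaf K-R5 (part 3, the END of
# the leaf): THE MATRIX SANDWICH `Wᵀ · P · W` WITH A BLOCK-PERIODIC TWO-POINT KERNEL, ENTRYWISE — its decimated second
# moment is `N^{−(d+2)}` × the BASE-POINT AVERAGE `N^{−d} Σ_{b ∈ box N} Σ'_t t_κ t_λ P_{ab}(b+t, b)` of the fine second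
# moment; in bond units and `d = 4`: EQUAL to that average

HONEST FRAMING (cell contract, verbatim): «discharging `BetaPertH` makes Bałaban's UV stability UNCONDITIONAL — a real
constructive-QFT result; it is NOT the continuum limit and NOT the Clay problem.»  [folklore] bookkeeping of absolutely
convergent lattice sums over `ℝ`, composed BY NAME from `MomentTransferPeriodicSum.decimatedSumP_second_moment_lattice`
(this leaf, parts 1–2); it is `DressedMomentNormalisation.secondMoment_dressedEntry_hasSum_lattice` /
`bondSecondMoment_hasSum(_four)` (an2-g5) with the translation-invariant Hessian kernel `T c e (s − s')` replaced by a
block-periodic two-point kernel `P c e s s'` — EXACTLY the statement asked for as K-R5 by the typer brief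
`HOME/b2b-balaban-beta-d1-p2/TYPER-SPEC-D1BFx.md` §2 («conclusion = `N^{−(d+2)} · (1/N^d) · Σ_{b ∈ box n} Σ'_w w_κ w_λ
P b (b+w)` — i.e. the BASE-POINT AVERAGE»; here the base point is the column index: `baseKer P b t = P (b+t) b`).
Nothing of the manuscripts under audit is asserted or cited; no `Prop` fact minted; the response kernel `w` and the
fine Hessian kernel `P` of road BF-x are NOT constructed here (typer rows T1–T8, K-R2); nothing of D1 / BetaPertH is
discharged.  Value = kernel bookkeeping leaf of road BF-x (skeleton `HOME/beta/skeletons/D1-b2b-balaban-beta-d1-p2.md`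
v1.4 node R5), NOT summit progress; NOT continuum, NOT Clay.  HONEST DEPENDENCY (verbatim): continuum YM on T⁴ ⇐
BetaPertH ∧ nine spine estimates (0/9 proved); BetaPertH ⇐ (D1) ∧ (D4) ∧ CAP+tail; G-an2-4 gates asym, D1 and NE2/3/4.

WHERE THE CROSS TERMS WENT (for leaf A4 of the road).  The typer brief expected «the cross terms of
`MomentFactorisation.M2_dressed_ward` … when (T0)/(T1) hold only for the piece's TOTAL over intra-block positions».  The
nine-term identity `MomentTransferPeriodicMaster.hasSum_termP_second` lists them as explicit finite sums over base points;
under the hypotheses used HERE — (i) the kernel kills constants on both sides POINTWISE (`Σ_s P s b = 0 = Σ_{s'} P b s'`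
at every `b`; the per-piece Ward identity in kernel form is a ROW-sum statement), (ii) BOTH response patterns reproduce
constants AND affine functions through `N•ℤ^d` (`KernelRepresentationSummable.lowMomentsSum_of_spec` supplies exactly this
for a kernel-represented minimiser), (iii) the base-point-SUMMED first moments vanish (automatic for a SYMMETRIC kernel:
`MomentTransferPeriodicSum.sum_firstMoment_baseKer_eq_zero_of_symm`) — ALL EIGHT CROSS TERMS VANISH IDENTICALLY; what A4
has to bound is only what (i)–(iii) do not cover for the road's actual pieces.

CONTENT (all [folklore], over `ℝ`, `d`, `N` general unless stated): `EKer₂`, `dressedEntryP` (= `dressedEntry` for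
translation-invariant entries), `avgM2` (the base-point average; = `Σ'_t t_κ t_λ T t` for translation-invariant `T`),
**`secondMoment_dressedEntryP_hasSum_lattice`** (spec normalisation: value `N^{−(d+2)} · avgM2`), `…_of_symm`,
**`bondSecondMomentP_hasSum`** (bond normalisation: `(N^d/N^4) · avgM2`), **`bondSecondMomentP_hasSum_four`** /
`_tsum_four` (`d = 4`: EQUALITY with the base-point average); a consistency `example` re-deriving an2's translation-invariant
theorem from the block-periodic one; §«solution operator»: the dressing side DISCHARGED for the
typed KKT solution operator's response kernel `MinimiserIdentityForm.wK N` (`lowMoments_wK`, `absMoment₂_wK` BY NAME):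
`bondSecondMomentP_solutionOp_four(_of_symm)` — hypotheses on the fine kernel `P` ONLY.
-/

namespace Summit.QuantumFields.BalabanUV.Beta.D1BFx.MomentTransferPeriodicEntry

open Finset Filter Topology
open Literature.MathematicalPhysics.QuantumFieldTheory.Balaban1983to89
open Literature.MathematicalPhysics.QuantumFieldTheory.Balaban1983to89.Beta
open DecimatedMoment (cosetInd)
open DecimatedMomentSummable (ConstReproSum LinReproSum AbsMoment₂ dressedSum)
open DressedMomentNormalisation (EKer dressedEntry resSite)
open MomentTransferPeriodic MomentTransferPeriodicSum

variable {d N : ℕ}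

/-- MATRIX two-point kernels, entrywise: `P c e : Ker₂ d`. [folklore] -/
abbrev EKer₂ (d : ℕ) : Type := Fin d → Fin d → Ker₂ d

/-- The `(a, b)` ENTRY OF THE SANDWICH `Σ'_{(u,x)} W(u)ᵀ · P(y + u, x) · W(x)` at the coarse output point `y`:
`Σ_{c,e} dressedSumP (w c a) (P c e) (w e b) y` (left factor = the transpose, as in `DressedMomentNormalisation.dressedEntry`).
[folklore] -/
noncomputable def dressedEntryP (w : EKer d) (P : EKer₂ d) (y : Fin d → ℤ) (a b : Fin d) : ℝ :=
  ∑ c, ∑ e, dressedSumP (w c a) (P c e) (w e b) y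

/-- CONSISTENCY: for translation-invariant entries `P c e s s' = T c e (s − s')` this IS `dressedEntry w T`. [folklore] -/
theorem dressedEntryP_of_transl (w T : EKer d) :
    dressedEntryP w (fun c e s s' => T c e (s - s')) = dressedEntry w T := by
  funext y a b
  simp only [dressedEntryP, dressedEntry, dressedSumP_of_transl]

/-- THE BASE-POINT AVERAGE of the fine second moment of a two-point kernel:
`avgM2 N Q κ λ = N^{−d} · Σ_{classes b} Σ'_t t_κ t_λ Q (b+t) b`. [folklore] -/
noncomputable def avgM2 (N : ℕ) (Q : Ker₂ d) (κ lam : Fin d) : ℝ :=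
  ((N : ℝ) ^ d)⁻¹ * ∑ r : Fin d → Fin N, ∑' t, (t κ : ℝ) * (t lam : ℝ) * baseKer Q (resSite r) t

/-- CONSISTENCY: for a translation-invariant kernel the base-point average is the plain second moment
`Σ'_t t_κ t_λ T t` (`0 < N`). [folklore] -/
theorem avgM2_of_transl (hN : 0 < N) (T : (Fin d → ℤ) → ℝ) (κ lam : Fin d) :
    avgM2 N (fun s s' => T (s - s')) κ lam = ∑' t, (t κ : ℝ) * (t lam : ℝ) * T t := by
  have hN' : (N : ℝ) ≠ 0 := by exact_mod_cast hN.ne'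
  unfold avgM2
  simp only [baseKer_of_transl]
  rw [Finset.sum_const, Finset.card_univ, Fintype.card_pi, Finset.prod_const, Finset.card_univ, Fintype.card_fin,
    Fintype.card_fin, nsmul_eq_mul, Nat.cast_pow]
  field_simp

/-- **THE DECIMATED SECOND MOMENT OF AN ENTRY OF THE SANDWICH WITH A BLOCK-PERIODIC KERNEL** (spec normalisation;
`0 < N`).  Response kernel `w` with entrywise (L0∞) Kronecker masses `δ_{κl} · N^{−(d+1)}`, entrywise (L1∞) and absolutely
summable second moments (EXACTLY the hypotheses of `DressedMomentNormalisation.secondMoment_dressedEntry_hasSum_lattice`);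
fine kernel entries `P c e` block periodic with absolutely summable base-point kernels, columns and rows summing to zero
at every point, base-point-summed first moments zero.  Then `z ↦ (N² z_κ z_λ) • K_{ab}(N z)` HAS THE SUM
`N^{−(d+2)} · avgM2 N (P a b) κ λ` — the translation-invariant value `N^{−(d+2)} · Σ'_t t_κ t_λ T a b t` with the second
moment replaced by its BASE-POINT AVERAGE. [folklore] -/
theorem secondMoment_dressedEntryP_hasSum_lattice (hN : 0 < N) (w : EKer d) (P : EKer₂ d)
    (hP : ∀ c e, IsBlockPeriodic N (P c e))
    (hw0 : ∀ κ l, ConstReproSum N (w κ l) (if κ = l then (((N : ℝ) ^ (d + 1))⁻¹) else 0))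
    (hw1 : ∀ κ l, ∃ C : Fin d → ℝ, LinReproSum N (w κ l) C)
    (hwA : ∀ κ l, AbsMoment₂ (w κ l)) (hPA : ∀ c e b, AbsMoment₂ (baseKer (P c e) b))
    (hcol : ∀ c e b, HasSum (fun s => P c e s b) 0) (hrow : ∀ c e b, HasSum (P c e b) 0)
    (hT1 : ∀ c e (μ : Fin d), ∑ r : Fin d → Fin N, ∑' t, (t μ : ℝ) * baseKer (P c e) (resSite r) t = 0)
    (κ lam a b : Fin d) :
    HasSum (fun z : Fin d → ℤ => ((N : ℤ) ^ 2 * (z κ * z lam)) • dressedEntryP w P ((N : ℤ) • z) a b)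
      ((((N : ℝ) ^ (d + 2))⁻¹) * avgM2 N (P a b) κ lam) := by
  have hN' : (N : ℝ) ≠ 0 := by exact_mod_cast hN.ne'
  have hce : ∀ c e : Fin d,
      HasSum (fun z : Fin d → ℤ => ((N : ℤ) ^ 2 * (z κ * z lam)) • dressedSumP (w c a) (P c e) (w e b) ((N : ℤ) • z))
        ((if c = a then (((N : ℝ) ^ (d + 1))⁻¹) else 0) * (if e = b then (((N : ℝ) ^ (d + 1))⁻¹) else 0)
          * ∑ r : Fin d → Fin N, ∑' t, (t κ : ℝ) * (t lam : ℝ) * baseKer (P c e) (resSite r) t) := by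
    intro c e
    obtain ⟨C, hC⟩ := hw1 c a
    obtain ⟨C', hC'⟩ := hw1 e b
    exact decimatedSumP_second_moment_lattice hN (hP c e) (hwA c a) (hwA e b) (hPA c e) (hw0 c a) hC (hw0 e b) hC'
      (hcol c e) (hrow c e) (hT1 c e) κ lam
  have hs := hasSum_sum (s := (Finset.univ : Finset (Fin d)))
    (fun c _ => hasSum_sum (s := (Finset.univ : Finset (Fin d))) (fun e _ => hce c e))
  have hval : ∑ c, ∑ e, (if c = a then (((N : ℝ) ^ (d + 1))⁻¹) else 0) * (if e = b then (((N : ℝ) ^ (d + 1))⁻¹) else 0)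
        * ∑ r : Fin d → Fin N, ∑' t, (t κ : ℝ) * (t lam : ℝ) * baseKer (P c e) (resSite r) t
      = (((N : ℝ) ^ (d + 2))⁻¹) * avgM2 N (P a b) κ lam := by
    simp only [mul_ite, mul_zero, ite_mul, zero_mul, Finset.sum_ite_eq', Finset.mem_univ, if_true]
    unfold avgM2
    field_simp
    ring
  rw [hval] at hs
  refine hs.congr_fun (fun z => ?_)
  simp only [dressedEntryP, Finset.smul_sum]

/-- **… FOR SYMMETRIC ENTRIES KILLING CONSTANTS**: if every entry kernel is symmetric (`P c e s s' = P c e s' s`) and its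
rows sum to zero at every point, the column and first-moment hypotheses are automatic. [folklore] -/
theorem secondMoment_dressedEntryP_hasSum_lattice_of_symm (hN : 0 < N) (w : EKer d) (P : EKer₂ d)
    (hP : ∀ c e, IsBlockPeriodic N (P c e)) (hsymm : ∀ c e s s', P c e s s' = P c e s' s)
    (hw0 : ∀ κ l, ConstReproSum N (w κ l) (if κ = l then (((N : ℝ) ^ (d + 1))⁻¹) else 0))
    (hw1 : ∀ κ l, ∃ C : Fin d → ℝ, LinReproSum N (w κ l) C)
    (hwA : ∀ κ l, AbsMoment₂ (w κ l)) (hPA : ∀ c e b, AbsMoment₂ (baseKer (P c e) b))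
    (hrow : ∀ c e b, HasSum (P c e b) 0) (κ lam a b : Fin d) :
    HasSum (fun z : Fin d → ℤ => ((N : ℤ) ^ 2 * (z κ * z lam)) • dressedEntryP w P ((N : ℤ) • z) a b)
      ((((N : ℝ) ^ (d + 2))⁻¹) * avgM2 N (P a b) κ lam) :=
  secondMoment_dressedEntryP_hasSum_lattice hN w P hP hw0 hw1 hwA hPA
    (fun c e b' => (hrow c e b').congr_fun (fun s => hsymm c e s b')) hrow
    (fun c e μ => sum_firstMoment_baseKer_eq_zero_of_symm hN (hP c e) (hsymm c e)
      (absMoment₂_periodicMajorant (hPA c e)) (abs_baseKer_le_periodicMajorant hN (hP c e)) μ) κ lam a b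

/-- **BOND NORMALISATION** (`K_bond = N^{2d} · K`, coarse units): the coarse bond second moment of the `(a,b)` entry has
the sum `(N^d / N^4) · avgM2 N (P a b) κ λ` (cf. `DressedMomentNormalisation.bondSecondMoment_hasSum`). [folklore] -/
theorem bondSecondMomentP_hasSum (hN : 0 < N) (w : EKer d) (P : EKer₂ d)
    (hP : ∀ c e, IsBlockPeriodic N (P c e))
    (hw0 : ∀ κ l, ConstReproSum N (w κ l) (if κ = l then (((N : ℝ) ^ (d + 1))⁻¹) else 0))
    (hw1 : ∀ κ l, ∃ C : Fin d → ℝ, LinReproSum N (w κ l) C)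
    (hwA : ∀ κ l, AbsMoment₂ (w κ l)) (hPA : ∀ c e b, AbsMoment₂ (baseKer (P c e) b))
    (hcol : ∀ c e b, HasSum (fun s => P c e s b) 0) (hrow : ∀ c e b, HasSum (P c e b) 0)
    (hT1 : ∀ c e (μ : Fin d), ∑ r : Fin d → Fin N, ∑' t, (t μ : ℝ) * baseKer (P c e) (resSite r) t = 0)
    (κ lam a b : Fin d) :
    HasSum (fun z : Fin d → ℤ => ((z κ * z lam : ℤ) : ℝ) * ((N : ℝ) ^ (2 * d) * dressedEntryP w P ((N : ℤ) • z) a b))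
      ((N : ℝ) ^ d / (N : ℝ) ^ 4 * avgM2 N (P a b) κ lam) := by
  have hN' : (N : ℝ) ≠ 0 := by exact_mod_cast hN.ne'
  have h := (secondMoment_dressedEntryP_hasSum_lattice hN w P hP hw0 hw1 hwA hPA hcol hrow hT1 κ lam a b).mul_left
    ((N : ℝ) ^ (2 * d) / (N : ℝ) ^ 2)
  have hval : (N : ℝ) ^ (2 * d) / (N : ℝ) ^ 2 * ((((N : ℝ) ^ (d + 2))⁻¹) * avgM2 N (P a b) κ lam)
      = (N : ℝ) ^ d / (N : ℝ) ^ 4 * avgM2 N (P a b) κ lam := by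
    field_simp
    ring
  rw [hval] at h
  refine h.congr_fun (fun z => ?_)
  simp only [zsmul_eq_mul, Int.cast_mul, Int.cast_pow, Int.cast_natCast]
  field_simp

/-- **`d = 4`: THE COARSE BOND SECOND MOMENT OF THE SANDWICH EQUALS THE BASE-POINT AVERAGE OF THE FINE SECOND MOMENT**
— at every fixed block size `N ≥ 1`, an identity, no estimate. [folklore] -/
theorem bondSecondMomentP_hasSum_four (hN : 0 < N) (w : EKer 4) (P : EKer₂ 4)
    (hP : ∀ c e, IsBlockPeriodic N (P c e))
    (hw0 : ∀ κ l, ConstReproSum N (w κ l) (if κ = l then (((N : ℝ) ^ (4 + 1))⁻¹) else 0))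
    (hw1 : ∀ κ l, ∃ C : Fin 4 → ℝ, LinReproSum N (w κ l) C)
    (hwA : ∀ κ l, AbsMoment₂ (w κ l)) (hPA : ∀ c e b, AbsMoment₂ (baseKer (P c e) b))
    (hcol : ∀ c e b, HasSum (fun s => P c e s b) 0) (hrow : ∀ c e b, HasSum (P c e b) 0)
    (hT1 : ∀ c e (μ : Fin 4), ∑ r : Fin 4 → Fin N, ∑' t, (t μ : ℝ) * baseKer (P c e) (resSite r) t = 0)
    (κ lam a b : Fin 4) :
    HasSum (fun z : Fin 4 → ℤ => ((z κ * z lam : ℤ) : ℝ) * ((N : ℝ) ^ 8 * dressedEntryP w P ((N : ℤ) • z) a b))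
      (avgM2 N (P a b) κ lam) := by
  have hN' : (N : ℝ) ≠ 0 := by exact_mod_cast hN.ne'
  have h := bondSecondMomentP_hasSum hN w P hP hw0 hw1 hwA hPA hcol hrow hT1 κ lam a b
  rw [show (2 * 4 : ℕ) = 8 from rfl, div_self (pow_ne_zero 4 hN'), one_mul] at h
  exact h

/-- `tsum` form of the `d = 4` identity. [folklore] -/
theorem bondSecondMomentP_tsum_four (hN : 0 < N) (w : EKer 4) (P : EKer₂ 4)
    (hP : ∀ c e, IsBlockPeriodic N (P c e))
    (hw0 : ∀ κ l, ConstReproSum N (w κ l) (if κ = l then (((N : ℝ) ^ (4 + 1))⁻¹) else 0))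
    (hw1 : ∀ κ l, ∃ C : Fin 4 → ℝ, LinReproSum N (w κ l) C)
    (hwA : ∀ κ l, AbsMoment₂ (w κ l)) (hPA : ∀ c e b, AbsMoment₂ (baseKer (P c e) b))
    (hcol : ∀ c e b, HasSum (fun s => P c e s b) 0) (hrow : ∀ c e b, HasSum (P c e b) 0)
    (hT1 : ∀ c e (μ : Fin 4), ∑ r : Fin 4 → Fin N, ∑' t, (t μ : ℝ) * baseKer (P c e) (resSite r) t = 0)
    (κ lam a b : Fin 4) :
    ∑' z : Fin 4 → ℤ, ((z κ * z lam : ℤ) : ℝ) * ((N : ℝ) ^ 8 * dressedEntryP w P ((N : ℤ) • z) a b)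
      = avgM2 N (P a b) κ lam :=
  (bondSecondMomentP_hasSum_four hN w P hP hw0 hw1 hwA hPA hcol hrow hT1 κ lam a b).tsum_eq

/-- **`d = 4`, SYMMETRIC ENTRIES KILLING CONSTANTS**: the coarse bond second moment of the sandwich equals the base-point
average of the fine second moment, with only periodicity, symmetry, row sums zero and summability assumed of `P`.
[folklore] -/
theorem bondSecondMomentP_tsum_four_of_symm (hN : 0 < N) (w : EKer 4) (P : EKer₂ 4)
    (hP : ∀ c e, IsBlockPeriodic N (P c e)) (hsymm : ∀ c e s s', P c e s s' = P c e s' s)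
    (hw0 : ∀ κ l, ConstReproSum N (w κ l) (if κ = l then (((N : ℝ) ^ (4 + 1))⁻¹) else 0))
    (hw1 : ∀ κ l, ∃ C : Fin 4 → ℝ, LinReproSum N (w κ l) C)
    (hwA : ∀ κ l, AbsMoment₂ (w κ l)) (hPA : ∀ c e b, AbsMoment₂ (baseKer (P c e) b))
    (hrow : ∀ c e b, HasSum (P c e b) 0) (κ lam a b : Fin 4) :
    ∑' z : Fin 4 → ℤ, ((z κ * z lam : ℤ) : ℝ) * ((N : ℝ) ^ 8 * dressedEntryP w P ((N : ℤ) • z) a b)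
      = avgM2 N (P a b) κ lam :=
  bondSecondMomentP_tsum_four hN w P hP hw0 hw1 hwA hPA
    (fun c e b' => (hrow c e b').congr_fun (fun s => hsymm c e s b')) hrow
    (fun c e μ => sum_firstMoment_baseKer_eq_zero_of_symm hN (hP c e) (hsymm c e)
      (absMoment₂_periodicMajorant (hPA c e)) (abs_baseKer_le_periodicMajorant hN (hP c e)) μ) κ lam a b

/-- **CONSISTENCY WITH THE TRANSLATION-INVARIANT THEOREM** (the check that the letters are right): for entries
`P c e s s' = T c e (s − s')` the hypotheses of `DressedMomentNormalisation.secondMoment_dressedEntry_hasSum_lattice`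
((T0), (T1) per entry) imply the present ones (rows and columns by translation, (T1-avg) trivially), `dressedEntryP = dressedEntry`,
`avgM2 = Σ'_t t_κ t_λ T a b t`, and the present theorem RETURNS an2's value `N^{−(d+2)} · Σ'_t (t_κ t_λ) • T a b t`.
(An `example`, not a declaration: the statement IS the landed theorem's, re-derived here from the block-periodic one.)
[folklore] -/
example (hN : 0 < N) (w T : EKer d)
    (hw0 : ∀ κ l, ConstReproSum N (w κ l) (if κ = l then (((N : ℝ) ^ (d + 1))⁻¹) else 0))
    (hw1 : ∀ κ l, ∃ C : Fin d → ℝ, LinReproSum N (w κ l) C)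
    (hwA : ∀ κ l, AbsMoment₂ (w κ l)) (hTA : ∀ c e, AbsMoment₂ (T c e))
    (hT0 : ∀ c e, HasSum (T c e) 0) (hT1 : ∀ c e (μ : Fin d), HasSum (fun t => t μ • T c e t) 0)
    (κ lam a b : Fin d) :
    HasSum (fun z : Fin d → ℤ => ((N : ℤ) ^ 2 * (z κ * z lam)) • dressedEntry w T ((N : ℤ) • z) a b)
      ((((N : ℝ) ^ (d + 2))⁻¹) * ∑' t, (t κ * t lam) • T a b t) := by
  have hcol : ∀ c e (b' : Fin d → ℤ), HasSum (fun s => (fun c e (s s' : Fin d → ℤ) => T c e (s - s')) c e s b') 0 :=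
    fun c e b' => (Equiv.hasSum_iff (Equiv.subRight b')).mpr (hT0 c e)
  have hrow : ∀ c e (b' : Fin d → ℤ), HasSum ((fun c e (s s' : Fin d → ℤ) => T c e (s - s')) c e b') 0 :=
    fun c e b' => (Equiv.hasSum_iff (Equiv.subLeft b')).mpr (hT0 c e)
  have hT1' : ∀ c e (μ : Fin d),
      ∑ r : Fin d → Fin N, ∑' t, (t μ : ℝ) * baseKer ((fun c e (s s' : Fin d → ℤ) => T c e (s - s')) c e) (resSite r) t
        = 0 := by
    intro c e μ
    have h1 : ∑' t, (t μ : ℝ) * T c e t = 0 := by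
      have := (hT1 c e μ).tsum_eq
      simpa only [zsmul_eq_mul] using this
    simp only [baseKer_of_transl, h1, Finset.sum_const_zero]
  have h := secondMoment_dressedEntryP_hasSum_lattice hN w (fun c e s s' => T c e (s - s'))
    (fun c e => isBlockPeriodic_of_transl (T c e)) hw0 hw1 hwA
    (fun c e b' => by rw [baseKer_of_transl]; exact hTA c e) hcol hrow hT1' κ lam a b
  rw [dressedEntryP_of_transl, avgM2_of_transl hN] at h
  have e : ∑' t : Fin d → ℤ, (t κ * t lam) • T a b t = ∑' t : Fin d → ℤ, (t κ : ℝ) * (t lam : ℝ) * T a b t :=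
    tsum_congr (fun t => by rw [zsmul_eq_mul, Int.cast_mul])
  rwa [e]

/-! ## The dressing side discharged: the typed KKT solution operator's response kernel `wK N` (d + 1 = 4) -/

section SolutionOperator

open MinimiserIdentityForm (wK lowMoments_wK absMoment₂_wK)

/-- **THE SANDWICH DRESSED BY THE TYPED SOLUTION OPERATOR** (`d + 1 = 4`, block size `N ≠ 0`): for the response kernel
`wK N` of `KernelSpecInstance.specK` (its (L0∞)/(L1∞)/`AbsMoment₂` are `MinimiserIdentityForm.lowMoments_wK` /
`absMoment₂_wK`, IN TREE) and ANY block-periodic matrix two-point kernel `P` with absolutely summable base-point kernels,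
columns and rows summing to zero pointwise and base-point-summed first moments zero, the coarse BOND second moment of
`wKᵀ · P · wK` EQUALS the base-point average `avgM2 N (P a b) κ λ` — hypotheses on `P` only.  («solution operator» /
«minimiser» is the LABEL of `MinimiserIdentityForm`; its identification with Bałaban's minimiser is the cell's reading,
not used here.) [folklore] -/
theorem bondSecondMomentP_solutionOp_four [NeZero N] (P : EKer₂ 4) (hP : ∀ c e, IsBlockPeriodic N (P c e))
    (hPA : ∀ c e b, AbsMoment₂ (baseKer (P c e) b))
    (hcol : ∀ c e b, HasSum (fun s => P c e s b) 0) (hrow : ∀ c e b, HasSum (P c e b) 0)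
    (hT1 : ∀ c e (μ : Fin 4), ∑ r : Fin 4 → Fin N, ∑' t, (t μ : ℝ) * baseKer (P c e) (resSite r) t = 0)
    (κ lam a b : Fin 4) :
    ∑' z : Fin 4 → ℤ, ((z κ * z lam : ℤ) : ℝ) * ((N : ℝ) ^ 8 * dressedEntryP (wK N) P ((N : ℤ) • z) a b)
      = avgM2 N (P a b) κ lam :=
  bondSecondMomentP_tsum_four (Nat.pos_of_ne_zero (NeZero.ne N)) (wK N) P hP lowMoments_wK.1 lowMoments_wK.2
    absMoment₂_wK hPA hcol hrow hT1 κ lam a b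

/-- … for SYMMETRIC entries killing constants (rows summing to zero pointwise): periodicity, symmetry, row sums and
summability of `P` are ALL that is assumed. [folklore] -/
theorem bondSecondMomentP_solutionOp_four_of_symm [NeZero N] (P : EKer₂ 4) (hP : ∀ c e, IsBlockPeriodic N (P c e))
    (hsymm : ∀ c e s s', P c e s s' = P c e s' s) (hPA : ∀ c e b, AbsMoment₂ (baseKer (P c e) b))
    (hrow : ∀ c e b, HasSum (P c e b) 0) (κ lam a b : Fin 4) :
    ∑' z : Fin 4 → ℤ, ((z κ * z lam : ℤ) : ℝ) * ((N : ℝ) ^ 8 * dressedEntryP (wK N) P ((N : ℤ) • z) a b)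
      = avgM2 N (P a b) κ lam :=
  bondSecondMomentP_tsum_four_of_symm (Nat.pos_of_ne_zero (NeZero.ne N)) (wK N) P hP hsymm lowMoments_wK.1
    lowMoments_wK.2 absMoment₂_wK hPA hrow κ lam a b

end SolutionOperator

end Summit.QuantumFields.BalabanUV.Beta.D1BFx.MomentTransferPeriodicEntry
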